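import Literature.Probability.Percolation.ArmSeparationFourArmProofs
import HarnessLib

/-!
# Well-separated `k`-arm events for `k ≤ 6` arms of ANY colours, and their deterministic gluing

Topic: Probability / Percolation; family `crit-perc` (critical site percolation on the triangular
lattice `𝕋`; hexagonal annuli `Λ_N ∖ Λ_n`, `Λ_n = triBall n`, `|·|_𝕋 = triNorm`; the order-free
arm events `armEvent κ n N` of `ArmEvents.lean`). A brick for the named fact
`Literature.Probability.Percolation.Nolin2008_prop17_quasiMult` (`FiveArmExponentFacts.lean`;
P. Nolin, *Near-critical percolation in two dimensions*, EJP 13 (2008), §4.5 Prop. 17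
[arXiv 0711.4948: Prop. 16], quasi-multiplicativity for every number of arms and every colour
sequence), isolating the ONE input that is not in the tree — Nolin's arm-separation theorem
(Thm. 11 [arXiv Thm. 10]) for a general pattern — in the tree's vocabulary, uniformly in the
pattern. The tree's gluing layer `ArmSeparationFourArm.lean` (Nolin's Prop. 12 [arXiv Prop. 11],
the `j = 4`, `σ = BWBW` instance) is in fact written one arm at a time: a fenced arm of colour `b`
landing on the middle halves of the `i`-th sides, `sepArmAt i b X n N`, glued or extended inside its
own rotated cone (`sepArmAt_glue_path`, `sepArmAt_glueExt_path`), arms on different sides living in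
disjoint zones (`glueZone_disjoint`). This file assembles these per-arm statements for an
ARBITRARY colour sequence `κ : Fin k → Bool` with `k ≤ 6`, the `j`-th arm landing on side `j`:

* `sepArms κ n N` — **the well-separated `k`-arm event** (Nolin's `Ã̃^{η,I/η',I'}_{k,κ}(n, N)`,
  §4.2 Def. 6–8 of the arXiv text, `η = η' = 1/64`, landing sequence "middle half of side `j`" for
  the `j`-th arm on both `∂Λ_n` and `∂Λ_N`, relaxed as in `sepOpenArm`): carriers
  `X j ⊆ Site 2` with `ω ∈ sepArmAt j (κ j) (X j) n N` for every `j`, the carriers of two arms of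
  the SAME colour being disjoint (arms of different colours are disjoint automatically); its
  one-colour halves `sepArmsCol κ b n N` (increasing for `b = true`, decreasing for `b = false`),
  `sepArms_eq_inter`, locality `determinedBy_sepArmsCol`;
* `sepArmsGlueCol κ b q`, `sepArmsGlueExtCol κ b q` — the gluing / extension events of
  `ArmSeparationFourArm.lean` (`fourGlue q`, `fourGlueExt q`, between `∂Λ_{64q}` and `∂Λ_{512(q+1)}`)
  read in colour `b` in the frames of the sides `j` with `κ j = b`;
* `sepArms_glue_subset` — **gluing** (Nolin, proof of Prop. 12 (ii)):
  `sepArms κ n₁ (64q) ∩ (glue events) ∩ sepArms κ (512(q+1)) n₃ ⊆ armEvent κ n₁ n₃`;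
  `sepArms_glueExt_subset` — **extension** (Prop. 12 (i)):
  `sepArms κ n₁ (64q) ∩ (extension events) ⊆ armEvent κ n₁ (512(q+1) - 1)`.

The probabilistic half (Nolin's Lemma 13 with the open cones as increasing region and the closed
cones as decreasing region, RSW for the gluing events, quasi-multiplicativity of `polyArmProb κ`
from the separation hypothesis `c · polyArmProb κ n N ≤ P_{1/2}(sepArms κ n N)`) is
`SepArmsQuasiMult.lean`. Everything here is PROVED; no named fact is introduced.

Faithfulness. For `k ≤ 6` the hexagon has enough sides to give each arm its own landing side, which
is the tree's format (`sepFourArm = ` open arms on sides `0, 3`, closed on `1, 4`; here side `j` for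
arm `j`, so `sepArms ![T,F,T,F]` lands on sides `0,1,2,3` — a different but equally admissible
landing sequence in Nolin's Thm. 11, "uniformly in all landing sequences `I/I'` of size `η/η'`").
For `k ≥ 7` landing arcs finer than sides are needed and nothing here applies. The order-free
`armEvent κ` versus Nolin's cyclically ordered `A_{j,σ}`: see the docstring of
`Nolin2008_prop17_quasiMult`; the prescribed landing sides fix the cyclic order of the colours to
that of `κ`.

## References

* P. Nolin, *Near-critical percolation in two dimensions*, Electron. J. Probab. 13 (2008),
  1562–1623, §4.2 (Def. 6–8 of arXiv 0711.4948), §4.3 Thm. 11, Prop. 12 [arXiv Thm. 10, Prop. 11],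
  §4.5 Prop. 17 [arXiv Prop. 16]. [Nolin2008]
* H. Kesten, *Scaling relations for 2D-percolation*, Comm. Math. Phys. 109 (1987) (fences). [Kesten1987]

Tree: `sepArmAt`, `isUpperSet_sepArmAt_true`, `isLowerSet_sepArmAt_false`, `determinedBy_sepArmAt`,
`sepConeSupport`, `fourGlue`, `fourGlueExt`, `readFrame`, `glueZone`, `glueZone_disjoint`,
`disjoint_inter_colour`, `sepArmAt_glue_path`, `sepArmAt_glueExt_path`, `mem_armEvent_of_disjointPaths`
(`ArmSeparationFourArm.lean`); `DeterminedBy.iUnion`, `DeterminedBy.iInter` (`SiteMonotonicity.lean`).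
-/

noncomputable section

open MeasureTheory Set

namespace Literature.Probability.Percolation

open LatticeModels

variable {k : ℕ}

/-! ### The events -/

/-- **The well-separated `k`-arm event with colours `κ`, `k ≤ 6`** (Nolin 2008, §4.2, the event
`Ã̃^{η,I/η',I'}_{k,κ}(n, N)` with `η = η' = 1/64` and the landing sequence "middle halves of side `j`
of `∂Λ_n` and of `∂Λ_N` for the `j`-th arm", relaxed arm by arm as in `sepOpenArm`): a family of
carriers `X j` such that `ω` has a fenced arm of colour `κ j` landing on side `j` confined to `X j`
(`sepArmAt j (κ j) (X j) n N`), carriers of arms of the same colour being pairwise disjoint. [cite: Nolin2008, §4.2, well-separated arm events with landing areas (arXiv 0711.4948: Def. 6–8)] -/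
def sepArms (κ : Fin k → Bool) (n N : ℕ) : Set (SiteConfig (Site 2)) :=
  {ω | ∃ X : Fin k → Set (Site 2), (∀ i j, i ≠ j → κ i = κ j → Disjoint (X i) (X j)) ∧
    ∀ j : Fin k, ω ∈ sepArmAt j.val (κ j) (X j) n N}

/-- **The arms of colour `b` of `sepArms κ n N`**: carriers for the indices `j` with `κ j = b` only. [cite: Nolin2008, §4.2, well-separated arm events with landing areas (arXiv 0711.4948: Def. 6–8)] -/
def sepArmsCol (κ : Fin k → Bool) (b : Bool) (n N : ℕ) : Set (SiteConfig (Site 2)) :=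
  {ω | ∃ X : Fin k → Set (Site 2), (∀ i j, i ≠ j → κ i = b → κ j = b → Disjoint (X i) (X j)) ∧
    ∀ j : Fin k, κ j = b → ω ∈ sepArmAt j.val b (X j) n N}

/-- `sepArms κ` is contained in each of its one-colour halves. [folklore] -/
theorem sepArms_subset_sepArmsCol (κ : Fin k → Bool) (b : Bool) (n N : ℕ) :
    sepArms κ n N ⊆ sepArmsCol κ b n N := by
  rintro ω ⟨X, hX, hA⟩
  refine ⟨X, fun i j hij hi hj => hX i j hij (hi.trans hj.symm), fun j hj => ?_⟩
  have h := hA j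
  rwa [hj] at h

/-- The two one-colour halves together give `sepArms κ` (merge the carriers by colour). [folklore] -/
theorem sepArmsCol_inter_subset (κ : Fin k → Bool) (n N : ℕ) :
    sepArmsCol κ true n N ∩ sepArmsCol κ false n N ⊆ sepArms κ n N := by
  classical
  rintro ω ⟨⟨X, hX, hA⟩, ⟨Y, hY, hB⟩⟩
  refine ⟨fun j => if κ j = true then X j else Y j, fun i j hij hκ => ?_, fun j => ?_⟩
  · dsimp only
    by_cases hi : κ i = true
    · have hj : κ j = true := hκ ▸ hi
      rw [if_pos hi, if_pos hj]
      exact hX i j hij hi hj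
    · have hi' : κ i = false := by simpa using hi
      have hj' : κ j = false := hκ ▸ hi'
      have hj : ¬ κ j = true := by rw [hj']; decide
      rw [if_neg hi, if_neg hj]
      exact hY i j hij hi' hj'
  · dsimp only
    by_cases hj : κ j = true
    · rw [if_pos hj, hj]
      exact hA j hj
    · have hj' : κ j = false := by simpa using hj
      rw [if_neg hj, hj']
      exact hB j hj'

/-- `sepArms κ = (open half) ∩ (closed half)`. [folklore] -/
theorem sepArms_eq_inter (κ : Fin k → Bool) (n N : ℕ) :
    sepArms κ n N = sepArmsCol κ true n N ∩ sepArmsCol κ false n N :=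
  Subset.antisymm (fun _ h => ⟨sepArms_subset_sepArmsCol κ true n N h, sepArms_subset_sepArmsCol κ false n N h⟩)
    (sepArmsCol_inter_subset κ n N)

/-- The open half is increasing. [folklore] -/
theorem isUpperSet_sepArmsCol_true (κ : Fin k → Bool) (n N : ℕ) : IsUpperSet (sepArmsCol κ true n N) := by
  rintro ω ω' hle ⟨X, hX, hA⟩
  exact ⟨X, hX, fun j hj => isUpperSet_sepArmAt_true _ _ _ _ hle (hA j hj)⟩

/-- The closed half is decreasing. [folklore] -/
theorem isLowerSet_sepArmsCol_false (κ : Fin k → Bool) (n N : ℕ) : IsLowerSet (sepArmsCol κ false n N) := by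
  rintro ω ω' hle ⟨X, hX, hA⟩
  exact ⟨X, hX, fun j hj => isLowerSet_sepArmAt_false _ _ _ _ hle (hA j hj)⟩

/-- **Locality of the one-colour halves**: `sepArmsCol κ b n N` is determined by any set of sites
containing the rotated cone supports `ρ^j(sepConeSupport n N)` of the sides `j` of colour `b`
(`4 ≤ n ≤ N`). [folklore] -/
theorem determinedBy_sepArmsCol (κ : Fin k → Bool) (b : Bool) {n N : ℕ} (h4 : 4 ≤ n) (hnN : n ≤ N)
    {F : Set (Site 2)} (hF : ∀ j : Fin k, κ j = b → triRotIsoPow j.val '' sepConeSupport n N ⊆ F) :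
    DeterminedBy (sepArmsCol κ b n N) F := by
  have h : sepArmsCol κ b n N = ⋃ X : Fin k → Set (Site 2),
      ⋃ (_ : ∀ i j, i ≠ j → κ i = b → κ j = b → Disjoint (X i) (X j)),
        ⋂ j : Fin k, ⋂ (_ : κ j = b), sepArmAt j.val b (X j) n N := by
    ext ω
    simp only [sepArmsCol, mem_setOf_eq, mem_iUnion, mem_iInter, exists_prop]
  rw [h]
  exact DeterminedBy.iUnion fun X => DeterminedBy.iUnion fun _ =>
    DeterminedBy.iInter fun j => DeterminedBy.iInter fun hj => (determinedBy_sepArmAt _ b (X j) h4 hnN).mono (hF j hj)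

/-- **The gluing events of the arms of colour `b`**: the one-cone gluing event `fourGlue q` of
`ArmSeparationFourArm.lean` read in colour `b` in the frame of every side `j` with `κ j = b`. [cite: Nolin2008, §4.3 Prop. 12 (proof) (arXiv 0711.4948: Prop. 11)] -/
def sepArmsGlueCol (κ : Fin k → Bool) (b : Bool) (q : ℕ) : Set (SiteConfig (Site 2)) :=
  ⋂ j : Fin k, ⋂ (_ : κ j = b), readFrame j.val b ⁻¹' fourGlue q

/-- **The extension events of the arms of colour `b`** (`fourGlueExt q` in the frames of colour `b`). [cite: Nolin2008, §4.3 Prop. 12 (proof) (arXiv 0711.4948: Prop. 11)] -/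
def sepArmsGlueExtCol (κ : Fin k → Bool) (b : Bool) (q : ℕ) : Set (SiteConfig (Site 2)) :=
  ⋂ j : Fin k, ⋂ (_ : κ j = b), readFrame j.val b ⁻¹' fourGlueExt q

/-- Membership in `sepArmsGlueCol`, unfolded. [folklore] -/
theorem mem_sepArmsGlueCol {κ : Fin k → Bool} {b : Bool} {q : ℕ} {ω : SiteConfig (Site 2)} :
    ω ∈ sepArmsGlueCol κ b q ↔ ∀ j : Fin k, κ j = b → readFrame j.val b ω ∈ fourGlue q := by
  simp only [sepArmsGlueCol, mem_iInter, mem_preimage]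

/-- Membership in `sepArmsGlueExtCol`, unfolded. [folklore] -/
theorem mem_sepArmsGlueExtCol {κ : Fin k → Bool} {b : Bool} {q : ℕ} {ω : SiteConfig (Site 2)} :
    ω ∈ sepArmsGlueExtCol κ b q ↔ ∀ j : Fin k, κ j = b → readFrame j.val b ω ∈ fourGlueExt q := by
  simp only [sepArmsGlueExtCol, mem_iInter, mem_preimage]

/-- On both one-colour gluing events, every arm's frame carries the gluing event in its colour. [folklore] -/
theorem readFrame_mem_fourGlue_of_mem {κ : Fin k → Bool} {q : ℕ} {ω : SiteConfig (Site 2)}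
    (hT : ω ∈ sepArmsGlueCol κ true q) (hF : ω ∈ sepArmsGlueCol κ false q) (j : Fin k) :
    readFrame j.val (κ j) ω ∈ fourGlue q := by
  rw [mem_sepArmsGlueCol] at hT hF
  cases hj : κ j
  · exact hF j hj
  · exact hT j hj

/-- The same for the extension events. [folklore] -/
theorem readFrame_mem_fourGlueExt_of_mem {κ : Fin k → Bool} {q : ℕ} {ω : SiteConfig (Site 2)}
    (hT : ω ∈ sepArmsGlueExtCol κ true q) (hF : ω ∈ sepArmsGlueExtCol κ false q) (j : Fin k) :
    readFrame j.val (κ j) ω ∈ fourGlueExt q := by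
  rw [mem_sepArmsGlueExtCol] at hT hF
  cases hj : κ j
  · exact hF j hj
  · exact hT j hj

/-! ### Deterministic gluing and extension -/

/-- **Zones of different arms are disjoint**: for `i ≠ j` (sides `< 6`), the glued zones
intersected with the respective colour classes are disjoint — by `glueZone_disjoint` for two arms of
the same colour (whose carriers are disjoint), by the colours otherwise. [cite: Nolin2008, §4.3 Prop. 12 (proof) (arXiv 0711.4948: Prop. 11)] -/
theorem glueZone_colour_disjoint (hk : k ≤ 6) (κ : Fin k → Bool) {q n₁ n₃ : ℕ} (hq : 1 ≤ q)
    {X Y : Fin k → Set (Site 2)} (hX : ∀ i j, i ≠ j → κ i = κ j → Disjoint (X i) (X j))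
    (hY : ∀ i j, i ≠ j → κ i = κ j → Disjoint (Y i) (Y j)) (ω : SiteConfig (Site 2)) {i j : Fin k} (hij : i ≠ j) :
    Disjoint (glueZone q n₁ n₃ i.val (X i) (Y i) ∩ {v | v ∈ ω ↔ κ i}) (glueZone q n₁ n₃ j.val (X j) (Y j) ∩ {v | v ∈ ω ↔ κ j}) := by
  by_cases hκ : κ i = κ j
  · have hij' : (i : ℕ) ≠ (j : ℕ) := fun h => hij (Fin.ext h)
    exact Disjoint.mono inter_subset_left inter_subset_left
      (glueZone_disjoint hq (lt_of_lt_of_le i.2 hk) (lt_of_lt_of_le j.2 hk) hij' (hX i j hij hκ) (hY i j hij hκ))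
  · exact disjoint_inter_colour hκ

/-- **Gluing `k ≤ 6` well-separated arms of any colours** (Nolin 2008, proof of Prop. 12 (ii)
[arXiv 0711.4948: Prop. 11], at the scales `64q ≤ 512(q+1)`; Kesten 1987): well-separated `k`-arm
events across `Λ_{64q} ∖ Λ_{n₁}` and across `Λ_{n₃} ∖ Λ_{512(q+1)}` together with the gluing events
in the `k` frames contain `armEvent κ n₁ n₃`: each arm is glued in its own frame
(`sepArmAt_glue_path`) and the glued arms live in pairwise disjoint zones
(`glueZone_colour_disjoint`), hence are disjoint arms (`mem_armEvent_of_disjointPaths`). [cite: Nolin2008, §4.3 Prop. 12 (arXiv 0711.4948: Prop. 11)] -/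
theorem sepArms_glue_subset (hk : k ≤ 6) (κ : Fin k → Bool) {q n₁ n₃ : ℕ} (hq : 1 ≤ q) (h4 : 4 ≤ n₁)
    (h₁ : n₁ ≤ 64 * q) (h₃ : 512 * (q + 1) ≤ n₃) :
    sepArms κ n₁ (64 * q) ∩ (sepArmsGlueCol κ true q ∩ sepArmsGlueCol κ false q) ∩
        sepArms κ (512 * (q + 1)) n₃ ⊆ armEvent κ n₁ n₃ := by
  rintro ω ⟨⟨⟨X, hX, hA⟩, hGT, hGF⟩, ⟨Y, hY, hB⟩⟩
  refine mem_armEvent_of_disjointPaths κ (fun j => glueZone q n₁ n₃ j.val (X j) (Y j) ∩ {v | v ∈ ω ↔ κ j})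
    (fun i j hij => glueZone_colour_disjoint hk κ hq hX hY ω hij) fun j => ?_
  obtain ⟨x, y, hx, hy, hp⟩ :=
    sepArmAt_glue_path hq h4 h₁ h₃ (hA j) (readFrame_mem_fourGlue_of_mem hGT hGF j) (hB j)
  refine ⟨x, y, hx, hy, hp.mono ?_⟩
  rintro v ⟨⟨hvZ, hvA⟩, hvc⟩
  exact ⟨⟨⟨hvZ, hvc⟩, hvA⟩, hvc⟩

/-- **Extending `k ≤ 6` well-separated arms of any colours** (Nolin 2008, Prop. 12 (i)
[arXiv 0711.4948: Prop. 11], extendability): a well-separated `k`-arm event across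
`Λ_{64q} ∖ Λ_{n₁}` together with the extension events in the `k` frames contains
`armEvent κ n₁ (512(q+1) - 1)`. [cite: Nolin2008, §4.3 Prop. 12 (arXiv 0711.4948: Prop. 11)] -/
theorem sepArms_glueExt_subset (hk : k ≤ 6) (κ : Fin k → Bool) {q n₁ : ℕ} (hq : 1 ≤ q) (h4 : 4 ≤ n₁)
    (h₁ : n₁ ≤ 64 * q) :
    sepArms κ n₁ (64 * q) ∩ (sepArmsGlueExtCol κ true q ∩ sepArmsGlueExtCol κ false q) ⊆
      armEvent κ n₁ (512 * (q + 1) - 1) := by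
  rintro ω ⟨⟨X, hX, hA⟩, hGT, hGF⟩
  set n₃ := 512 * (q + 1) with hn₃
  have hE : ∀ i j : Fin k, i ≠ j → κ i = κ j → Disjoint ((fun _ => (∅ : Set (Site 2))) i) ((fun _ => (∅ : Set (Site 2))) j) :=
    fun _ _ _ _ => disjoint_bot_left
  refine mem_armEvent_of_disjointPaths κ (fun j => glueZone q n₁ n₃ j.val (X j) ∅ ∩ {v | v ∈ ω ↔ κ j})
    (fun i j hij => glueZone_colour_disjoint hk κ hq hX hE ω hij) fun j => ?_
  obtain ⟨x, y, hx, hy, hp⟩ :=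
    sepArmAt_glueExt_path n₃ hq h4 h₁ (hA j) (readFrame_mem_fourGlueExt_of_mem hGT hGF j)
  refine ⟨x, y, hx, hy, hp.mono ?_⟩
  rintro v ⟨⟨hvZ, hvA⟩, hvc⟩
  exact ⟨⟨⟨hvZ, hvc⟩, hvA⟩, hvc⟩

end Literature.Probability.Percolation

end
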